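import Summits.HodgeConjecture.HodgeConjecture.Theorems.Ring2HypothesesDescentAbsolutePrimitiveMiddle
import Summits.HodgeConjecture.HodgeConjecture.Theorems.Ring2HypothesesDescentAbsoluteMiddleGeneral
import HarnessLib

/-!
# Ring 2 — hypotheses layer, descent axis: THE PARENT NODE `AbsoluteHodgeImpliesAlgebraic` IS "LEFSCHETZ-PRIMITIVE ABSOLUTE
# HODGE CLASSES IN THE MIDDLE DEGREE OF EVEN-DIMENSIONAL SMOOTH PROJECTIVE VARIETIES ARE ALGEBRAIC" — no `B(X)`, no Lieberman
# (modulo (N)+(E)+(c)); the descent from ring2-b02's lift for a GENERAL variety is slice + Gysin, fact-free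

HONEST FRAMING (page 1, verbatim the cell's standing line): **research route conditional on HC_CM; not a
corollary; Q11.4-sentence-2 already refuted in dim ≥ 3.** Nothing in this file proves a case of the Hodge conjecture;
nothing discharges the binder of record b06 `Ring2.Hypotheses.AbsoluteHodgeImpliesAlgebraicAV` or its parent node
`AbsoluteHodgeImpliesAlgebraic` (`Ring2HypothesesDescent.lean` :73 / :66; both OPEN); the binder table's numbers do not
move. `HC_CM` (`Theses.RankFourFaces.CMAbelianHodge`) does not occur in this file; `HC_AV` is not asserted.

Hodge ladder STAGE 3, `BINDER-OWNERS.md` row **b06**, seat `ring2-b06` (gen 72). Gen 71 of this seat gave ROW b06 its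
primitive-middle form (`absoluteHodgeImpliesAlgebraicAV_iff_primitiveMiddle_of_canonical`, fourth file) and the PARENT node its
middle-degree form without `B(X)` (`absoluteHodgeImpliesAlgebraic_iff_middleDegree_of_canonical`, fifth file), recording as NOT
claimed "a primitive-AND-middle form of the PARENT node (the descent of ring2-b02's lift uses `X ≅` abelian variety + Lieberman;
for general `X` it would need the algebraicity of `*_L`, i.e. `B(X)` again)". That residual is removed here. The descent of
algebraicity from ring2-b02's primitive one-step lift `v_s(c) = L_{pr_X^*η} pr_X^* c − s · L_{pr_E^*κ} pr_X^* c` on `X × E` (`E` an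
elliptic curve) needs neither: the SLICE `X × {t}` turns `v_s(c)` into `L_η c` (ring2-b02's own first step), so
`pr_X^*(L_η c) = L_{pr_X^*η} pr_X^* c` is algebraic, hence so is `s · pr_X^* c ∪ pr_E^* κ = pr_X^*(L_η c) − v_s(c)`, and for `s ≠ 0`,
`κ ≠ 0` the GYSIN push-forward along `pr_X` returns `c` (gen 71's fact-free `mem_algebraicClasses_of_cross_top_mem`:
`pr_{X*}(pr_X^* c ∪ pr_E^* κ) = deg κ · c`, Gysin maps preserve the coniveau).

* §1 `ne_zero_of_isPolarizationClass` (a polarisation class of a positive-dimensional variety is non-zero, hard Lefschetz from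
  `H⁰`); `lefschetzOperator_mem_algebraicClasses_of_primitiveLift_mem` (the slice: `v_s(c)` algebraic ⟹ `L_η c` algebraic, any
  smooth projective `X`; ring2-b02's first step, count once THEIRS); **`mem_algebraicClasses_of_primitiveLift_mem_of_ne_zero`**
  (`v_s(c)` algebraic, `s ≠ 0`, `κ ≠ 0`, `dim E = 1` ⟹ `c` algebraic — ANY smooth projective `X`, fact-free).
* §2 `mem_algebraicClasses_of_absoluteHodge_primitive_of_forall_primitiveMiddle_general` — the defect induction of AbelianAll
  XXVIII / gen 71 for a GENERAL smooth projective `X` (modulo (N)+(E)+(c)): if on every smooth projective `Y` of even dimension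
  `2m ≥ 4` and for every polarisation class `θ` every θ-primitive absolute Hodge class of `H^{2m}(Y(ℂ); ℂ)` is algebraic, then
  every η-primitive absolute Hodge class of codimension `p ≥ 2`, `2p + d = n`, on every smooth projective `n`-fold is algebraic
  (one lift per unit of defect: primitive by ring2-b02, absolute Hodge by gen 71's third file, descent by §1).
* §3 **`absoluteHodgeImpliesAlgebraic_iff_primitiveMiddle_of_canonical`: THE PARENT NODE `↔` "every Lefschetz-PRIMITIVE absolute
  Hodge class in the MIDDLE degree `H^{2m}` of every smooth projective complex variety of even dimension `2m ≥ 4` (every hard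
  Lefschetz datum) is algebraic"** (modulo (N) `chartConjugation_canonical`, (E) existence of conjugates, (c)
  `deligne1982_lefschetz_absoluteHodge_iff`; NO standard conjecture, NO abelian hypothesis) — through gen 71's
  `absoluteHodgeImpliesAlgebraic_iff_primitive_of_canonical` and §2; the polarisation-class spelling, the `¬`-form (a
  counterexample to Charles–Schnell's Conjecture 11.2.18, if any, can be taken PRIMITIVE and in the MIDDLE degree of an
  even-dimensional variety of dimension `≥ 4`), the (G)-keyed form. First cell with content: a smooth projective FOURFOLD and a
  primitive absolute Hodge class in `H⁴`.

HONEST COLUMN. Nothing is discharged; «10 · 0» unchanged; parent node, row b06, `HC_AV` OPEN and NOT asserted; (N), (E)/(G), (c)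
are named facts displayed as hypotheses; no definition, no named fact, no sorry. NOT claimed: that the primitive-middle form is
strictly weaker than the parent node; anything for the `ℚ̄`-variant `AbsoluteHodgeImpliesAlgebraicQbar`. COUNT ONCE: the lift, its
primitivity and the slice step are ring2-b02's; the defect induction is ab-spread-1's (XXVIII) / gen 71's; the Gysin descent and
the parent's middle form are gen 71's; this file contributes the general-variety descent and the assembled equivalence.

References (bib keys): Deligne1982HodgeCycles (§2 Ex. 2.1 (c), (d) p. 16), CharlesSchnell2014Notes (Def. 11.2.3, §11.2.2
(11.2.2)–(11.2.3), Prop. 11.2.7, Cor. 11.2.12, Conj. 11.2.18, Prop. 11.3.11), VoisinHodgeI2002 (§6.2.3 Def. 6.24, Thm. 6.25,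
Cor. 6.26, Rem. 6.27, §7.1.2), VoisinHodgeII2003 (§9.2.4 Prop. 9.20, Prop. 9.21), Kleiman1968AlgebraicCycles (§1.4 (1.4.6),
Thm. 2.9), KerrPearlstein2011 (§3.1), BrosnanFangNiePearlstein2009 (§6 Lemma 48), Fulton1998 (§10.1 Cor. 10.1, Example 10.1.2),
FultonYoungTableaux1997 (App. B §B.1 (5)–(7)), HatcherAT2002 (§3.2 Prop. 3.10, Thm. 3.11, §3.3 Thm. 3.26), Hartshorne1977
(II.3 p. 89), MumfordAV1970 (§1), SilvermanAEC2009 (III.3.6). -/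

noncomputable section

set_option linter.dupNamespace false

open CategoryTheory AlgebraicGeometry MonoidalCategory CartesianMonoidalCategory
open Literature.AlgebraicTopology.SingularHomology Literature.Geometry.Kaehler
open Literature.AlgebraicGeometry Literature.AlgebraicGeometry.Motives
open Literature.AlgebraicGeometry.HodgeTheory
open Summit.HodgeConjecture.HodgeConjecture.Theorems
open Summit.HodgeConjecture.HodgeConjecture.Ring2.Binders (primitiveLift_mem_primitiveClasses map_lefschetzOperator
  complexBetti_specOver_eq_zero)

namespace Summit.HodgeConjecture.HodgeConjecture.Ring2.Hypotheses

/-! ## §1 Descent of algebraicity from ring2-b02's lift on a GENERAL smooth projective variety (fact-free) -/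

section Descent

variable {n : ℕ} {X : SchemeOver ℂ}

/-- **A polarisation class of a positive-dimensional smooth projective variety is non-zero**: `L_ηⁿ : H⁰ → H²ⁿ` is bijective
(hard Lefschetz from degree `0`) and `1 ≠ 0` in `H⁰(X(ℂ); ℂ)` (`X(ℂ)` is non-empty), while `L_0 = 0`. [cite: VoisinHodgeI2002, §6.2.3 Thm. 6.25]
[cite: HatcherAT2002, §3.2 Prop. 3.10] -/
theorem ne_zero_of_isPolarizationClass (hX : IsSmoothProjective n X) {η : complexBetti X 2} (hη : IsPolarizationClass n X η)
    (hn : 1 ≤ n) : η ≠ 0 := by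
  rintro rfl
  obtain ⟨k, rfl⟩ : ∃ k, n = k + 1 := ⟨n - 1, by omega⟩
  haveI := pathConnectedSpace_complexPoints hX
  have hinj := (bijective_lefschetzPowTo_of_hasHardLefschetz (0 : complexBetti X 2) hη.hasHardLefschetz
    (show 0 + (k + 1) = k + 1 by omega) (2 * (k + 1)) (by omega)).1
  refine singularCohomology_one_ne_zero (R := ℂ) (M := ComplexPoints X) (hinj ?_)
  rw [map_zero, lefschetzPowTo_succ_apply (0 : complexBetti X 2) k 0 (0 + 2 * k) (2 * (k + 1)) rfl (by omega) (by omega),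
    lefschetzOperator_apply, LinearMap.map_zero₂]

/-- **The slice of the lift** (ring2-b02's first step, for ANY smooth projective `X`; count once THEIRS): `X` smooth projective of
dimension `n`, `E` a complex abelian variety, `η ∈ H²(X(ℂ); ℂ)`, `κ ∈ H²(E(ℂ); ℂ)`, `s ∈ ℂ`. If
`v_s(c) = L_{pr_X^*η} pr_X^* c − s · L_{pr_E^*κ} pr_X^* c` is algebraic on `X × E`, then `L_η c = η ∪ c` is algebraic on `X`:
restrict to the fibre `X × {t}` of the constant family `X × E ⟶ E` (specialisation of algebraic classes,
`map_fiberι_mem_algebraicClasses`), identified with `X` by the slice (`sliceFiberIso`); there `pr_E^* κ` dies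
(`H²(Spec ℂ (ℂ); ℂ) = 0`). [cite: Fulton1998, §10.1 Cor. 10.1 and Example 10.1.2] [cite: CharlesSchnell2014Notes, Prop. 11.3.11 (proof)]
[cite: Hartshorne1977, II.3 (p. 89)] -/
theorem lefschetzOperator_mem_algebraicClasses_of_primitiveLift_mem (hX : IsSmoothProjective n X) (E : AbelianVariety ℂ)
    (η : complexBetti X 2) (κ : complexBetti E.X 2) {p : ℕ} {c : complexBetti X (2 * p)} (s : ℂ)
    (hz : lefschetzOperator (complexBetti.map (fst X E.X) 2 η) (two_add_two_mul p) (complexBetti.map (fst X E.X) (2 * p) c) -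
        s • lefschetzOperator (complexBetti.map (snd X E.X) 2 κ) (two_add_two_mul p)
          (complexBetti.map (fst X E.X) (2 * p) c) ∈ algebraicClasses (X ⊗ E.X) (p + 1)) :
    lefschetzOperator η (two_add_two_mul p) c ∈ algebraicClasses X (p + 1) := by
  have hE : IsSmoothProjective E.dim E.X := AbelianVariety.isSmoothProjective_holds
  haveI : IrreducibleSpace E.X.left := hE.irreducibleSpace
  haveI := hE.smoothOfRelativeDimension
  haveI : AlgebraicGeometry.Smooth E.X.hom := SmoothOfRelativeDimension.smooth E.dim E.X.hom
  obtain ⟨t⟩ := hE.nonempty_algPoints ℂ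
  -- restrict to the fibre of the constant family `X × E ⟶ E` over `t`, then to `X` along the slice isomorphism
  have h₁ := map_fiberι_mem_algebraicClasses (snd X E.X) (isSmoothProjectiveFamily_snd hX E.X)
    (IsQuasiProjectiveOver.of_isProjectiveOver hE.isProjectiveOver) hz t
  have h₂ := map_mem_algebraicClasses_of_isIso (sliceFiberIso X t).hom h₁
  rw [← complexBetti.map_comp_apply'] at h₂
  have hfst : ∀ {i : ℕ} (y : complexBetti X i), complexBetti.map ((sliceFiberIso X t).hom ≫ fiberι (snd X E.X) t) i
      (complexBetti.map (fst X E.X) i y) = y := fun y ↦ by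
    rw [← complexBetti.map_comp_apply', Category.assoc, sliceFiberIso_hom_fiberι_fst, complexBetti.map_id]; rfl
  have hsnd : complexBetti.map ((sliceFiberIso X t).hom ≫ fiberι (snd X E.X) t) 2 (complexBetti.map (snd X E.X) 2 κ) = 0 := by
    rw [← complexBetti.map_comp_apply', Category.assoc, sliceFiberIso_hom_fiberι_snd, complexBetti.map_comp_apply',
      complexBetti_specOver_eq_zero two_ne_zero (complexBetti.map t 2 κ), map_zero]
  rw [map_sub, map_smul, map_lefschetzOperator, map_lefschetzOperator, hfst, hfst, hsnd, lefschetzOperator_apply (0 : complexBetti X 2),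
    LinearMap.map_zero₂, smul_zero, sub_zero] at h₂
  exact h₂

/-- **DESCENT OF ALGEBRAICITY FROM THE LIFT, FOR ANY SMOOTH PROJECTIVE `X`** (fact-free; no `B(X)`, no Lieberman — contrast
ring2-b02's `mem_algebraicClasses_of_primitiveLift_mem`, which asks `X ≅` an abelian variety). `X` smooth projective of dimension
`n`, `E` a complex abelian variety of dimension `1`, `η ∈ H²(X(ℂ); ℂ)` arbitrary, `κ ∈ H²(E(ℂ); ℂ)` non-zero, `s ≠ 0`: if
`v_s(c) = L_{pr_X^*η} pr_X^* c − s · L_{pr_E^*κ} pr_X^* c` is algebraic on `X × E` then `c` is algebraic on `X`. The slice gives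
`L_η c` algebraic (`lefschetzOperator_mem_algebraicClasses_of_primitiveLift_mem`), so `pr_X^*(L_η c) = L_{pr_X^*η} pr_X^* c` is
(flat pull-back), hence `s · L_{pr_E^*κ} pr_X^* c = pr_X^*(L_η c) − v_s(c)` and `pr_X^* c ∪ pr_E^* κ` are; `κ` is a non-zero
TOP-degree class of the curve `E`, so the Gysin push-forward along `pr_X` returns a non-zero multiple of `c` inside `Nᵖ`
(gen 71's `mem_algebraicClasses_of_cross_top_mem`: projection formula + Gysin maps preserve the coniveau).
[cite: VoisinHodgeII2003, §9.2.4 Prop. 9.21] [cite: FultonYoungTableaux1997, Appendix B §B.1 (5)–(7)]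
[cite: Fulton1998, §10.1 Cor. 10.1] [cite: HatcherAT2002, §3.2 Thm. 3.11 and §3.3 Thm. 3.26] -/
theorem mem_algebraicClasses_of_primitiveLift_mem_of_ne_zero (hX : IsSmoothProjective n X) (E : AbelianVariety ℂ)
    (hE1 : E.dim = 1) (η : complexBetti X 2) {κ : complexBetti E.X 2} (hκ : κ ≠ 0) {p : ℕ} {c : complexBetti X (2 * p)}
    {s : ℂ} (hs : s ≠ 0)
    (hz : lefschetzOperator (complexBetti.map (fst X E.X) 2 η) (two_add_two_mul p) (complexBetti.map (fst X E.X) (2 * p) c) -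
        s • lefschetzOperator (complexBetti.map (snd X E.X) 2 κ) (two_add_two_mul p)
          (complexBetti.map (fst X E.X) (2 * p) c) ∈ algebraicClasses (X ⊗ E.X) (p + 1)) :
    c ∈ algebraicClasses X p := by
  have hE : IsSmoothProjective E.dim E.X := AbelianVariety.isSmoothProjective_holds
  have hE' : IsSmoothProjective 1 E.X := hE1 ▸ hE
  -- `pr_X^*(L_η c)` is algebraic
  have h₁ : lefschetzOperator (complexBetti.map (fst X E.X) 2 η) (two_add_two_mul p) (complexBetti.map (fst X E.X) (2 * p) c) ∈
      algebraicClasses (X ⊗ E.X) (p + 1) := by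
    rw [← map_lefschetzOperator]
    exact map_fst_mem_supportedClasses hX hE (lefschetzOperator_mem_algebraicClasses_of_primitiveLift_mem hX E η κ s hz)
  -- hence `s · L_{pr_E^*κ} pr_X^* c` and `pr_X^* c ∪ pr_E^* κ` are
  have h₂ := Submodule.sub_mem _ h₁ hz
  rw [sub_sub_cancel] at h₂
  have h₃ := Submodule.smul_mem _ s⁻¹ h₂
  rw [smul_smul, inv_mul_cancel₀ hs, one_smul,
    lefschetzOperator_map_snd_map_fst κ (two_add_two_mul p) (show 2 * p + 2 = 2 * (p + 1) by omega)] at h₃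
  -- push forward along `pr_X`
  exact mem_algebraicClasses_of_cross_top_mem hX hE' hκ h₃

end Descent

/-! ## §2 The defect induction on a general smooth projective variety (modulo (N)+(E)+(c)) -/

section Induction

/-- **DEFECT INDUCTION FOR ABSOLUTE HODGE CLASSES ON GENERAL SMOOTH PROJECTIVE VARIETIES.** Granted (N), (E), (c): suppose
that on every smooth projective complex `Y` of even dimension `2m ≥ 4` and for every polarisation class `θ` of `Y`, every
θ-PRIMITIVE ABSOLUTE HODGE class of the MIDDLE degree `H^{2m}(Y(ℂ); ℂ)` is algebraic. Then for every `d`, every smooth projective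
`X` of dimension `n`, every polarisation class `η` of `X` and every `p ≥ 2` with `2p + d = n`, every η-primitive absolute Hodge
class in `H^{2p}(X(ℂ); ℂ)` is algebraic. Induction on the defect `d` (AbelianAll XXVIII / gen 71, count once THEIRS, now without
the abelian hypothesis): `d = 0` is the hypothesis on `X` itself; `d = r + 1`: ring2-b02's lift `v_{r+1}(c)` on `X × E` (`E` an
elliptic curve with a polarisation class `κ`) is primitive of defect `r` for the exterior-sum polarisation
(`primitiveLift_mem_primitiveClasses`), ABSOLUTE HODGE (gen 71, `isAbsoluteHodgeClass_primitiveLift_of_canonical`), hence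
algebraic by the induction hypothesis on the `(n+1)`-fold `X × E`, and §1 descends (`r + 1 ≠ 0`, `κ ≠ 0`).
[cite: Deligne1982HodgeCycles, §2 Example 2.1 (c), (d) (p. 16)] [cite: VoisinHodgeI2002, §6.2.3 Def. 6.24, Cor. 6.26 and Rem. 6.27]
[cite: Kleiman1968AlgebraicCycles, §1.4 (1.4.6) and Thm. 2.9] [cite: KerrPearlstein2011, §3.1] [cite: SilvermanAEC2009, III.3.6] -/
theorem mem_algebraicClasses_of_absoluteHodge_primitive_of_forall_primitiveMiddle_general (hN : chartConjugation_canonical)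
    (hex : ∀ ⦃n : ℕ⦄ ⦃X : SchemeOver ℂ⦄, IsSmoothProjective n X →
      ∀ (σ : ℂ ≃+* ℂ) (p : ℕ) (c : complexBetti X (2 * p)), ∃ s, IsConjugateClass σ X (2 * p) c s)
    (h21c : deligne1982_lefschetz_absoluteHodge_iff)
    (hpm : ∀ ⦃N : ℕ⦄ ⦃Y : SchemeOver ℂ⦄, IsSmoothProjective N Y → ∀ m : ℕ, 2 ≤ m → N = 2 * m →
      ∀ ⦃θ : complexBetti Y 2⦄, IsPolarizationClass N Y θ →
        ∀ z : complexBetti Y (2 * m), IsAbsoluteHodgeClass N Y m z → z ∈ primitiveClasses θ N (2 * m) →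
          z ∈ algebraicClasses Y m) :
    ∀ (d : ℕ) {X : SchemeOver ℂ} {n : ℕ}, IsSmoothProjective n X →
      ∀ {η : complexBetti X 2}, IsPolarizationClass n X η → ∀ {p : ℕ}, 2 ≤ p → 2 * p + d = n →
        ∀ (c : complexBetti X (2 * p)), IsAbsoluteHodgeClass n X p c →
          c ∈ primitiveClasses η n (2 * p) → c ∈ algebraicClasses X p := by
  intro d
  induction d with
  | zero =>
    intro X n hX η hη p h2 hn c hc hprim
    exact hpm hX p h2 (by omega) hη c hc hprim
  | succ r ih =>
    intro X n hX η hη p h2 hn c hc hprim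
    -- an elliptic curve `E` with a polarisation class `κ ≠ 0`; `X × E` of dimension `n + 1`
    obtain ⟨E, hE1⟩ := exists_abelianVariety_dim_eq_one ℂ
    have hE : IsSmoothProjective E.dim E.X := AbelianVariety.isSmoothProjective_holds
    obtain ⟨κ, hκ⟩ := exists_isPolarizationClass hE
    have hκ0 : κ ≠ 0 := ne_zero_of_isPolarizationClass hE hκ (by omega)
    have hX' : IsSmoothProjective (n + E.dim) (X ⊗ E.X) := IsSmoothProjective.tensor_holds hX hE
    have hη' := isPolarizationClass_boxSum hX hE hη hκ
    -- the lift is primitive of defect `r` (ring2-b02) and ABSOLUTE HODGE (gen 71); the induction hypothesis applies on `X × E`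
    have hz := ih hX' hη' (p := p + 1) (by omega) (by omega) _
      (isAbsoluteHodgeClass_primitiveLift_of_canonical hN hex h21c hX hη E hκ hc (r + 1))
      (primitiveLift_mem_primitiveClasses E η κ hE1 hn hprim)
    -- descend (§1)
    exact mem_algebraicClasses_of_primitiveLift_mem_of_ne_zero hX E hE1 η hκ0 (by exact_mod_cast Nat.succ_ne_zero r) hz

/-- **PER VARIETY**: granted (N), (E), (c) and the primitive-middle hypothesis of the previous theorem, EVERY absolute Hodge class
on EVERY smooth projective `X` is algebraic (gen 71's per-variety reduction to `[H]`-primitive absolute Hodge classes below the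
middle, `forall_absoluteHodge_algebraic_of_primitive_of_canonical`, then §2 with `d = n − 2p`). The hypothesis is NOT asserted.
[cite: Deligne1982HodgeCycles, §2 Example 2.1 (c), (d) (p. 16)] [cite: VoisinHodgeI2002, §6.2.3 Thm. 6.25 and Cor. 6.26]
[cite: KerrPearlstein2011, §3.1] -/
theorem forall_absoluteHodge_algebraic_of_forall_primitiveMiddle_of_canonical (hN : chartConjugation_canonical)
    (hex : ∀ ⦃n : ℕ⦄ ⦃X : SchemeOver ℂ⦄, IsSmoothProjective n X →
      ∀ (σ : ℂ ≃+* ℂ) (p : ℕ) (c : complexBetti X (2 * p)), ∃ s, IsConjugateClass σ X (2 * p) c s)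
    (h21c : deligne1982_lefschetz_absoluteHodge_iff)
    (hpm : ∀ ⦃N : ℕ⦄ ⦃Y : SchemeOver ℂ⦄, IsSmoothProjective N Y → ∀ m : ℕ, 2 ≤ m → N = 2 * m →
      ∀ ⦃θ : complexBetti Y 2⦄, IsPolarizationClass N Y θ →
        ∀ z : complexBetti Y (2 * m), IsAbsoluteHodgeClass N Y m z → z ∈ primitiveClasses θ N (2 * m) →
          z ∈ algebraicClasses Y m)
    {n : ℕ} {X : SchemeOver ℂ} (hX : IsSmoothProjective n X) (p : ℕ) (c : complexBetti X (2 * p))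
    (hc : IsAbsoluteHodgeClass n X p c) : c ∈ algebraicClasses X p := by
  obtain ⟨Λ⟩ := nonempty_hardLefschetzNFold_holds n X hX
  refine forall_absoluteHodge_algebraic_of_primitive_of_canonical hN hex h21c hX Λ ?_ p c hc
  intro q hq hq2 a ha haAH
  exact mem_algebraicClasses_of_absoluteHodge_primitive_of_forall_primitiveMiddle_general hN hex h21c hpm (n - 2 * q) hX
    Λ.isPolarizationClass hq (by omega) a haAH ha

end Induction

/-! ## §3 The parent node is the algebraicity of primitive absolute Hodge classes in the middle degree of even-dimensional varieties -/

section Parent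

/-- **THE PARENT NODE `AbsoluteHodgeImpliesAlgebraic ↔` every Lefschetz-PRIMITIVE ABSOLUTE HODGE class in the MIDDLE degree
`H^{2m}` of every smooth projective complex variety of even dimension `2m ≥ 4`, for every hard Lefschetz datum `Λ`, is algebraic**
(modulo (N)+(E)+(c); NO standard conjecture `B(X)`, NO abelian hypothesis — gen 71's "NOT claimed" residual for the parent node,
removed by the fact-free descent of §1). `⟹` is the restriction; `⟸`: gen 71's `absoluteHodgeImpliesAlgebraic_iff_primitive_of_canonical`
asks for the η-primitive absolute Hodge classes of all codimensions `2 ≤ p ≤ n/2`, and §2 supplies them from the middle ones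
(a polarisation class IS `Λ'.hyperplaneClass` for some hard Lefschetz datum). Charles–Schnell's Conjecture 11.2.18 reduced to
primitive middle-degree classes — the absolute analogue of Lefschetz's reduction of the Hodge conjecture (Kerr–Pearlstein §3.1),
with `X × E` in place of `X × ℙʳ` and hyperplane sections. Neither side is asserted. [cite: CharlesSchnell2014Notes, §11.2.5 Conj. 11.2.18 and Prop. 11.2.7]
[cite: Deligne1982HodgeCycles, §2 Example 2.1 (c), (d) (p. 16)] [cite: VoisinHodgeI2002, §6.2.3 Def. 6.24, Thm. 6.25 and Cor. 6.26]
[cite: KerrPearlstein2011, §3.1] -/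
theorem absoluteHodgeImpliesAlgebraic_iff_primitiveMiddle_of_canonical (hN : chartConjugation_canonical)
    (hex : ∀ ⦃n : ℕ⦄ ⦃X : SchemeOver ℂ⦄, IsSmoothProjective n X →
      ∀ (σ : ℂ ≃+* ℂ) (p : ℕ) (c : complexBetti X (2 * p)), ∃ s, IsConjugateClass σ X (2 * p) c s)
    (h21c : deligne1982_lefschetz_absoluteHodge_iff) :
    AbsoluteHodgeImpliesAlgebraic ↔
      ∀ ⦃N : ℕ⦄ ⦃Y : SchemeOver ℂ⦄, IsSmoothProjective N Y → ∀ (Λ : HardLefschetzNFold N Y) (m : ℕ), 2 ≤ m → N = 2 * m →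
        ∀ z : complexBetti Y (2 * m), IsAbsoluteHodgeClass N Y m z →
          z ∈ primitiveClasses Λ.hyperplaneClass N (2 * m) → z ∈ algebraicClasses Y m := by
  refine ⟨fun h N Y hY _ m _ _ z hz _ ↦ h hY m z hz, fun h N Y hY p c hc ↦ ?_⟩
  refine forall_absoluteHodge_algebraic_of_forall_primitiveMiddle_of_canonical hN hex h21c ?_ hY p c hc
  intro M Z hZ m h2 hM θ hθ z hz hzprim
  obtain ⟨Λ', rfl⟩ := hθ.exists_hardLefschetzNFold hZ
  exact h hZ Λ' m h2 hM z hz hzprim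

/-- The same with POLARISATION CLASSES `θ` in place of hard Lefschetz data (every `Λ.hyperplaneClass` is one). Neither side is
asserted. [cite: CharlesSchnell2014Notes, §11.2.5 Conj. 11.2.18] [cite: VoisinHodgeI2002, Thm. 6.25 and Cor. 6.26] -/
theorem absoluteHodgeImpliesAlgebraic_iff_isPolarizationClass_primitiveMiddle_of_canonical (hN : chartConjugation_canonical)
    (hex : ∀ ⦃n : ℕ⦄ ⦃X : SchemeOver ℂ⦄, IsSmoothProjective n X →
      ∀ (σ : ℂ ≃+* ℂ) (p : ℕ) (c : complexBetti X (2 * p)), ∃ s, IsConjugateClass σ X (2 * p) c s)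
    (h21c : deligne1982_lefschetz_absoluteHodge_iff) :
    AbsoluteHodgeImpliesAlgebraic ↔
      ∀ ⦃N : ℕ⦄ ⦃Y : SchemeOver ℂ⦄, IsSmoothProjective N Y → ∀ m : ℕ, 2 ≤ m → N = 2 * m →
        ∀ ⦃θ : complexBetti Y 2⦄, IsPolarizationClass N Y θ →
          ∀ z : complexBetti Y (2 * m), IsAbsoluteHodgeClass N Y m z → z ∈ primitiveClasses θ N (2 * m) →
            z ∈ algebraicClasses Y m :=
  ⟨fun h _ _ hY m _ _ _ _ z hz _ ↦ h hY m z hz,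
    fun h _ _ hY p c hc ↦ forall_absoluteHodge_algebraic_of_forall_primitiveMiddle_of_canonical hN hex h21c h hY p c hc⟩

/-- **The `¬`-form: a counterexample to the parent node (Charles–Schnell Conj. 11.2.18), if any, can be taken Lefschetz-PRIMITIVE
AND in the MIDDLE degree of a smooth projective variety of even dimension `2m ≥ 4`** (modulo (N)+(E)+(c)). Neither side is
asserted. [cite: CharlesSchnell2014Notes, §11.2.5 Conj. 11.2.18] [cite: VoisinHodgeI2002, §6.2.3 Def. 6.24 and Thm. 6.25] -/
theorem not_absoluteHodgeImpliesAlgebraic_iff_exists_primitiveMiddle_of_canonical (hN : chartConjugation_canonical)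
    (hex : ∀ ⦃n : ℕ⦄ ⦃X : SchemeOver ℂ⦄, IsSmoothProjective n X →
      ∀ (σ : ℂ ≃+* ℂ) (p : ℕ) (c : complexBetti X (2 * p)), ∃ s, IsConjugateClass σ X (2 * p) c s)
    (h21c : deligne1982_lefschetz_absoluteHodge_iff) :
    ¬ AbsoluteHodgeImpliesAlgebraic ↔
      ∃ (N : ℕ) (Y : SchemeOver ℂ), IsSmoothProjective N Y ∧ ∃ (Λ : HardLefschetzNFold N Y) (m : ℕ), 2 ≤ m ∧ N = 2 * m ∧
        ∃ z : complexBetti Y (2 * m), IsAbsoluteHodgeClass N Y m z ∧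
          z ∈ primitiveClasses Λ.hyperplaneClass N (2 * m) ∧ z ∉ algebraicClasses Y m := by
  rw [absoluteHodgeImpliesAlgebraic_iff_primitiveMiddle_of_canonical hN hex h21c]
  push Not
  exact Iff.rfl

/-- **The parent node `↔` its primitive-middle form, keyed to the named facts (N), (G), (c)** ((E) from Grothendieck's comparison
fact (G) by gen 69's `exists_isConjugateClass_even_of_grothendieck`). None of (N), (G), (c) is asserted.
[cite: CharlesSchnell2014Notes, §11.2.2 (11.2.1)–(11.2.3) and Conj. 11.2.18] [cite: Deligne1982HodgeCycles, §2 Example 2.1 (c), (d) (p. 16)] -/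
theorem absoluteHodgeImpliesAlgebraic_iff_primitiveMiddle_of_grothendieck (hN : chartConjugation_canonical)
    (hG : grothendieck_comparison_realize_surjective) (h21c : deligne1982_lefschetz_absoluteHodge_iff) :
    AbsoluteHodgeImpliesAlgebraic ↔
      ∀ ⦃N : ℕ⦄ ⦃Y : SchemeOver ℂ⦄, IsSmoothProjective N Y → ∀ (Λ : HardLefschetzNFold N Y) (m : ℕ), 2 ≤ m → N = 2 * m →
        ∀ z : complexBetti Y (2 * m), IsAbsoluteHodgeClass N Y m z →
          z ∈ primitiveClasses Λ.hyperplaneClass N (2 * m) → z ∈ algebraicClasses Y m :=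
  absoluteHodgeImpliesAlgebraic_iff_primitiveMiddle_of_canonical hN (exists_isConjugateClass_even_of_grothendieck hG) h21c

/-- **Row b06 from the parent's primitive-middle form** (modulo (N)+(E)+(c)): if every primitive absolute Hodge class in the middle
degree of every even-dimensional smooth projective variety of dimension `≥ 4` is algebraic, then `AbsoluteHodgeImpliesAlgebraicAV`
(through the parent node, `absoluteHodgeImpliesAlgebraicAV_of_all`). The hypothesis is NOT asserted; row b06 is NOT discharged.
[cite: CharlesSchnell2014Notes, §11.2.5 Conj. 11.2.18] [cite: Deligne1982HodgeCycles, Intro pp. 5–7 and §2 Example 2.1 (c)] -/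
theorem absoluteHodgeImpliesAlgebraicAV_of_forall_primitiveMiddle_of_canonical (hN : chartConjugation_canonical)
    (hex : ∀ ⦃n : ℕ⦄ ⦃X : SchemeOver ℂ⦄, IsSmoothProjective n X →
      ∀ (σ : ℂ ≃+* ℂ) (p : ℕ) (c : complexBetti X (2 * p)), ∃ s, IsConjugateClass σ X (2 * p) c s)
    (h21c : deligne1982_lefschetz_absoluteHodge_iff)
    (hpm : ∀ ⦃N : ℕ⦄ ⦃Y : SchemeOver ℂ⦄, IsSmoothProjective N Y → ∀ (Λ : HardLefschetzNFold N Y) (m : ℕ), 2 ≤ m → N = 2 * m →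
      ∀ z : complexBetti Y (2 * m), IsAbsoluteHodgeClass N Y m z →
        z ∈ primitiveClasses Λ.hyperplaneClass N (2 * m) → z ∈ algebraicClasses Y m) :
    AbsoluteHodgeImpliesAlgebraicAV :=
  absoluteHodgeImpliesAlgebraicAV_of_all ((absoluteHodgeImpliesAlgebraic_iff_primitiveMiddle_of_canonical hN hex h21c).2 hpm)

end Parent

/-! ## Audit: nothing is decided here

No theorem above concludes `AbsoluteHodgeImpliesAlgebraic`, `AbsoluteHodgeImpliesAlgebraicAV`, `HC_AV` or `HC_CM` outright:
§1 is fact-free descent, the rest carries the undischarged hypotheses (N), (E)/(G), (c) (named facts of the tree, displayed,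
never asserted) and the primitive-middle hypothesis. Axiom closures: the three standard axioms. -/

#print axioms Summit.HodgeConjecture.HodgeConjecture.Ring2.Hypotheses.mem_algebraicClasses_of_primitiveLift_mem_of_ne_zero
#print axioms Summit.HodgeConjecture.HodgeConjecture.Ring2.Hypotheses.absoluteHodgeImpliesAlgebraic_iff_primitiveMiddle_of_canonical

end Summit.HodgeConjecture.HodgeConjecture.Ring2.Hypotheses

end
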